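import Summits.CriticalPhenomena.SAWScalingLimit.Theorems.SAWDevelopingMapHexTransferPortTransfer
import Summits.CriticalPhenomena.SAWScalingLimit.Theorems.SAWDevelopingMapHexTransferPortDictionary
import Summits.CriticalPhenomena.SAWScalingLimit.Theorems.SAWDevelopingMapHexTransferCompassRealisation

/-!
# `CompassSLE ↔ YBSquareSLE` (crux stmt-CriticalPhenomena-6965, line `registered`/`birth`)

Helper of the line lead for the crux `CompassSLE` (route SAWCompassLattice): the crux and the
route's item `YBSquareSLE` (stmt-CriticalPhenomena-6967, chordal SLE(8/3) convergence of
Glazman–Manolescu's critical `π/2` Yang–Baxter walk) are EQUIVALENT statements.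

* `→` (`compassSLE_of_ybSquareSLE`) is the landed port transfer of line `HexTransfer/Sketch`
  (`Cruxes.HexTransfer.Sketch.stub_portTransfer` fed with `stub_portDictionary`).
* `←` (`ybSquareSLE_of_compassSLE`, new) runs the same deterministic `O(δ)` coupling backwards:
  at a solution `(α, β, s, z)` of the compass equations (`stub_compassRealisation`), GM's law
  `ybLaw (π/2) Ω δ 1 a b` is the push-forward of the normalised compass path measure `ρ_δ` along
  `toYB` (`PortTransfer.ybLaw_eq_map`) while the compass chordal law is its push-forward along the
  drawing map (`PortTransfer.compassLaw_eq_map`); the two drawings of one path are at distance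
  `≤ |δ|` in `CurveClass ℂ` (`PortTransfer.dist_compassCurve_curve_le`), so convergence in law
  passes from the compass curves to the Yang–Baxter curves (`PortTransfer.tendstoLaw_of_dist_le`).

Consequence for the line: the open content of `CompassSLE` is exactly `YBSquareSLE`, which the
skeleton `Cruxes/CompassSLE/Lines/birth.lean` splits as tightness + identification + criterion.
-/

noncomputable section

namespace Summit.CriticalPhenomena.SAWScalingLimit.Theorems.SAWCompassLatticeCompassSLE

open MeasureTheory Filter Topology Set
open scoped NNReal ENNReal
open Literature.Probability.RandomPlanarGeometry
open Literature.Probability.RandomPlanarGeometry.SAW.YangBaxter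
open Summit.CriticalPhenomena.SAWScalingLimit.Theses
open Summit.CriticalPhenomena.SAWScalingLimit.Cruxes.HexTransfer.Sketch
open Summit.CriticalPhenomena.SAWScalingLimit.Cruxes.HexTransfer.Sketch.PortTransfer

/-- **`YBSquareSLE → CompassSLE`**: the landed port transfer composed with the landed port
dictionary (line `HexTransfer/Sketch`). -/
theorem compassSLE_of_ybSquareSLE (h : SAWCompassLattice.YBSquareSLE) :
    SAWCompassLattice.CompassSLE :=
  stub_portTransfer stub_portDictionary h

/-- **`CompassSLE → YBSquareSLE`**: the `O(δ)` coupling of line `HexTransfer/Sketch` run backwards.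
At a solution of the compass equations (`stub_compassRealisation`), the compass chordal law and
GM's `ybLaw (π/2)` are push-forwards of one normalised path measure along two drawings at
distance `≤ |δ|`, so chordal SLE(8/3) convergence of the compass curves gives that of the
Yang–Baxter curves (bounded-Lipschitz portmanteau, `tendstoLaw_of_dist_le`). -/
theorem ybSquareSLE_of_compassSLE (h : SAWCompassLattice.CompassSLE) :
    SAWCompassLattice.YBSquareSLE := by
  obtain ⟨α, β, s, z, hsol⟩ := stub_compassRealisation
  have hP : SAWCompassLattice.PortDictionary := stub_portDictionary
  have h' : ∀ (D : DobrushinDomain) (a b : ℝ → MidEdge),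
      IsYBEndpointApprox (fun (_ : ℤ) => Real.pi / 2) D a b →
        ConvergesInLawToSLE ((8 : NNReal) / 3) D (fun (_ : ℝ) (x : CurveClass ℂ) => x)
          (fun δ => compassLaw α β s z D.carrier δ (a δ) (b δ)) := h α β s z hsol
  intro D a b hab
  obtain ⟨Γ, hΓ, -, hT⟩ := h' D a b hab
  haveI := isProbabilityMeasure_preWienerMeasure'
  refine ⟨Γ, hΓ, Eventually.of_forall fun δ => YBWalk.aemeasurable_curve _ _ _ _ _ _, ?_⟩
  -- the compass side, rewritten as the law of the drawing map under the path measure `ρ_δ`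
  have hT' : TendstoLaw (fun δ (p : CPath D.carrier δ (a δ) (b δ)) => compassCurve δ p)
      (fun δ => compassRho α β s z D.carrier δ (a δ) (b δ)) Γ
      Literature.Probability.Process.preWienerMeasure := by
    intro f
    refine (hT f).congr fun δ => ?_
    change ∫ x, f x ∂(compassLaw α β s z D.carrier δ (a δ) (b δ)) = _
    rw [compassLaw_eq_map, integral_map (measurable_cpath _).aemeasurable
      f.continuous.aestronglyMeasurable]
  -- transfer along the O(δ) coupling to the Yang–Baxter drawing of the same path
  have hε : Tendsto (fun δ : ℝ => |δ|) (𝓝[>] 0) (𝓝 0) :=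
    (continuous_abs.tendsto' (0 : ℝ) 0 abs_zero).mono_left nhdsWithin_le_nhds
  have hT'' := tendstoLaw_of_dist_le
    (Y := fun δ (p : CPath D.carrier δ (a δ) (b δ)) =>
      (toYB hP hsol p).curve (fun (_ : ℤ) => Real.pi / 2) δ)
    (Y' := fun δ (p : CPath D.carrier δ (a δ) (b δ)) => compassCurve δ p)
    (fun δ => compassRho_zero_or_prob α β s z D.carrier δ (a δ) (b δ))
    (fun δ => (measurable_cpath _).aemeasurable) (fun δ => (measurable_cpath _).aemeasurable)
    hΓ.aemeasurable hε
    (fun δ p => (dist_comm _ _).trans_le (dist_compassCurve_curve_le p _ (toYB_mids hP hsol p)))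
    hT'
  -- back to GM's law on walks
  intro f
  refine (hT'' f).congr fun δ => ?_
  change _ = ∫ γ, f (γ.curve (fun (_ : ℤ) => Real.pi / 2) δ)
      ∂(ybLaw (fun (_ : ℤ) => Real.pi / 2) D.carrier δ 1 (a δ) (b δ))
  rw [ybLaw_eq_map hP hsol, integral_map (measurable_cpath _).aemeasurable]
  exact (YBWalk.measurable_of_top _).aestronglyMeasurable

/-- **The crux `CompassSLE` (stmt-CriticalPhenomena-6965) and the item `YBSquareSLE`
(stmt-CriticalPhenomena-6967) are equivalent.** -/
theorem compassSLE_iff_ybSquareSLE :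
    SAWCompassLattice.CompassSLE ↔ SAWCompassLattice.YBSquareSLE :=
  ⟨ybSquareSLE_of_compassSLE, compassSLE_of_ybSquareSLE⟩

end Summit.CriticalPhenomena.SAWScalingLimit.Theorems.SAWCompassLatticeCompassSLE

end
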